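import Literature.NumberTheory.Sieve.BombieriAsymptoticSieveDimension
import Literature.NumberTheory.Sieve.SelbergSymmetryFormula
import HarnessLib

/-!
# Bombieri's asymptotic sieve: Lemma 12 of Friedlander–Iwaniec (the main term `Σ₁`) from the fundamental lemma

Topic `Literature/NumberTheory/Sieve`, companion ("Proofs") file of `BombieriAsymptoticSieve.lean`
([BombieriRIMS1977]; [FriedlanderIwaniecPisa1978] §4). Source: J. Friedlander, H. Iwaniec,
*On Bombieri's asymptotic sieve*, Ann. Scuola Norm. Sup. Pisa Cl. Sci. (4) **5** (1978) 719–756,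
Lemma 12 (pp. 738–739), scalar case `(k)` with `k ≥ 2`, `K = ℚ`, `N = 1`.

Main result: `BombieriSieve.FI1978_lemma12_of_fundamentalLemma :
SieveSequence.fundamental_lemma_uniform → FI1978_lemma12` — the named fact `FI1978_lemma12` of
`BombieriAsymptoticSieve.lean` is reduced to the fundamental lemma of sieve theory
(`SieveSequence.fundamental_lemma_uniform` of `SieveFramework.lean`, Halberstam–Richert Thm 2.5 =
Friedlander–Iwaniec's "Lemma 5"); Lemmata 7, 8, 9 entering the proof are theorems of
`BombieriAsymptoticSieveLemmata.lean`. The printed proof is followed with one simplification: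
instead of the binomial expansion `(log n/d)^a = ∑_b (−1)^{a−b} (a choose b)(log d)^{a−b}(log n)^b`
the sieve is applied directly to the nonnegative weights `a_n (log⁺ n/d)^k`; all partial
summations are carried out in discrete form (Abel summation), the integral
`∫₁^x A(t) dt/t = β(x) A(x) log x` entering only through the exact identity
`∫₁^x A(t) dt/t = ∑_{n ≤ x} a_n log(x/n)` (`integral_size_div_eq`, from
`SelbergSymmetry.sum_mul_log_eq`).

* `sum_Ioc_mul_eq_sub_sum_range`, `abs_sum_Ioc_mul_le_of_monotone` — Abel summation against a
  monotone weight; `abs_weighted_congrSum_sub_le` — "partial summation (twice)":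
  `|∑_{n ≤ N, q ∣ n} a_n w(n) − g(q) ∑_{n ≤ N} a_n w(n)| ≤ 2 w(N) max_{m ≤ N} |R(m; q)|`;
* `logWeight_props`, `pow_log_sub_logWeight_bounds`, `size_mul_pow_log_sub_weightedSum_bounds`,
  `integral_size_div_eq` — the weight `φ_d(n) = (log⁺ n/d)^k` and
  `0 ≤ A(x)(log x/d)^k − ∑ a_n φ_d(n) ≤ k (log x)^{k−1} ∫₁^x A(t) dt/t`;
* `truncLambdaLower_eq_sum_divisors`, `sigma1_eq_sum_moebius_mul` — `Σ₁ = ∑_{d<y,(d,P(z))=1} μ(d)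
  ∑_{n ≤ x,(n,P(z))=1, d ∣ n} a_n φ_d(n)`;
* `weighted_sifted_sub_le` — the fundamental lemma for the auxiliary sequence `1_{d ∣ n} a_n w(n)`;
* `FI1978_lemma12_of_fundamentalLemma` — the assembly (constants `η` of Lemma 9,
  `C = C_F C₇ C₈ + 1 + k C₇ C₈ + C₉`, threshold `log x ≥ max(1, 2 C₂(ε) e^s)`).
-/

noncomputable section

open Filter Finset
open scoped Topology

namespace Literature.NumberTheory.Sieve

namespace BombieriSieve

open scoped ArithmeticFunction.Moebius
open MeasureTheory

/-! ### Abel summation against a monotone weight -/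

/-- Abel's identity `∑_{n ≤ N} e(n) φ(n) = E(N) φ(N) − ∑_{m < N} E(m) (φ(m+1) − φ(m))`,
`E(m) = ∑_{n ≤ m} e(n)`. [folklore] -/
theorem sum_Ioc_mul_eq_sub_sum_range (e φ : ℕ → ℝ) (N : ℕ) :
    ∑ n ∈ Ioc 0 N, e n * φ n =
      (∑ n ∈ Ioc 0 N, e n) * φ N -
        ∑ m ∈ Finset.range N, (∑ n ∈ Ioc 0 m, e n) * (φ (m + 1) - φ m) := by
  induction N with
  | zero => simp
  | succ N ih =>
    rw [Finset.sum_Ioc_succ_top (Nat.zero_le N), Finset.sum_Ioc_succ_top (Nat.zero_le N),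
      Finset.sum_range_succ, ih]
    ring

/-- **Abel summation against a monotone weight** (the "partial summation (twice)" of
[FriedlanderIwaniecPisa1978] p. 739, in discrete form): if `|∑_{n ≤ m} e(n)| ≤ R` for all
`m ≤ N` and `φ ≥ 0` is nondecreasing, then `|∑_{n ≤ N} e(n) φ(n)| ≤ 2 R φ(N)`. [folklore] -/
theorem abs_sum_Ioc_mul_le_of_monotone {e φ : ℕ → ℝ} {N : ℕ} {R : ℝ}
    (hR : ∀ m ≤ N, |∑ n ∈ Ioc 0 m, e n| ≤ R) (hφ : Monotone φ) (hφ0 : ∀ n, 0 ≤ φ n) :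
    |∑ n ∈ Ioc 0 N, e n * φ n| ≤ 2 * R * φ N := by
  have hR0 : 0 ≤ R := le_trans (abs_nonneg _) (hR 0 (Nat.zero_le N))
  rw [sum_Ioc_mul_eq_sub_sum_range]
  have h1 : |(∑ n ∈ Ioc 0 N, e n) * φ N| ≤ R * φ N := by
    rw [abs_mul, abs_of_nonneg (hφ0 N)]
    exact mul_le_mul_of_nonneg_right (hR N le_rfl) (hφ0 N)
  have h2 : |∑ m ∈ Finset.range N, (∑ n ∈ Ioc 0 m, e n) * (φ (m + 1) - φ m)| ≤ R * φ N := by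
    refine (Finset.abs_sum_le_sum_abs _ _).trans ?_
    have h3 : ∀ m ∈ Finset.range N, |(∑ n ∈ Ioc 0 m, e n) * (φ (m + 1) - φ m)| ≤
        R * (φ (m + 1) - φ m) := fun m hm => by
      have hΔ : 0 ≤ φ (m + 1) - φ m := sub_nonneg.mpr (hφ (Nat.le_succ m))
      rw [abs_mul, abs_of_nonneg hΔ]
      exact mul_le_mul_of_nonneg_right (hR m (Finset.mem_range.mp hm).le) hΔ
    refine (Finset.sum_le_sum h3).trans ?_
    rw [← Finset.mul_sum, Finset.sum_range_sub]
    exact mul_le_mul_of_nonneg_left (sub_le_self _ (hφ0 0)) hR0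
  calc |(∑ n ∈ Ioc 0 N, e n) * φ N -
        ∑ m ∈ Finset.range N, (∑ n ∈ Ioc 0 m, e n) * (φ (m + 1) - φ m)|
      ≤ |(∑ n ∈ Ioc 0 N, e n) * φ N| +
          |∑ m ∈ Finset.range N, (∑ n ∈ Ioc 0 m, e n) * (φ (m + 1) - φ m)| := abs_sub _ _
    _ ≤ R * φ N + R * φ N := add_le_add h1 h2
    _ = 2 * R * φ N := by ring

/-- **Remainders of weighted congruence sums.** For `A(x) = ∑_{n ≤ x} a_n`, a modulus `q`,
weights `w ≥ 0` nondecreasing, and `|R(m; q)| ≤ R` for all integers `m ≤ N`: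
`|∑_{n ≤ N, q ∣ n} a_n w(n) − g(q) ∑_{n ≤ N} a_n w(n)| ≤ 2 R w(N)` — the bound
"`O((log x)^b sup_{1 ≤ t ≤ x} |R(t, νd)|)`" of [FriedlanderIwaniecPisa1978] p. 739 (first display
after "Partial summation (twice) gives"). [cite: FriedlanderIwaniecPisa1978, Lemma 12 (proof, p. 739)] -/
theorem abs_weighted_congrSum_sub_le (A : SieveSequence) (hsize : ∀ x, A.size x = A.congrSum 1 x)
    {w : ℕ → ℝ} (hw0 : ∀ n, 0 ≤ w n) (hw : Monotone w) (q N : ℕ) {R : ℝ}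
    (hR : ∀ m : ℕ, m ≤ N → |A.remainder q (m : ℝ)| ≤ R) :
    |(∑ n ∈ (Ioc 0 N).filter (fun n : ℕ => q ∣ n), A.a n * w n) -
        A.density q * ∑ n ∈ Ioc 0 N, A.a n * w n| ≤ 2 * R * w N := by
  set e : ℕ → ℝ := fun n => (if q ∣ n then A.a n else 0) - A.density q * A.a n with he
  have hsum : (∑ n ∈ (Ioc 0 N).filter (fun n : ℕ => q ∣ n), A.a n * w n) -
      A.density q * ∑ n ∈ Ioc 0 N, A.a n * w n = ∑ n ∈ Ioc 0 N, e n * w n := by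
    rw [Finset.sum_filter, Finset.mul_sum, ← Finset.sum_sub_distrib]
    refine Finset.sum_congr rfl fun n _ => ?_
    simp only [he]
    split_ifs <;> ring
  have hpartial : ∀ m : ℕ, ∑ n ∈ Ioc 0 m, e n = A.remainder q (m : ℝ) := by
    intro m
    rw [SieveSequence.remainder, hsize, SieveSequence.congrSum, SieveSequence.congrSum,
      Nat.floor_natCast, Finset.sum_filter, Finset.filter_true_of_mem (fun n _ => one_dvd n),
      Finset.mul_sum, ← Finset.sum_sub_distrib]
  rw [hsum]
  exact abs_sum_Ioc_mul_le_of_monotone (fun m hm => by rw [hpartial]; exact hR m hm) hw hw0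

/-! ### The weight `φ_d(n) = (log⁺ (n/d))^k` -/

/-- Basic properties of `φ_d(n) = (max(0, log (n/d)))^k` for `d ≥ 1`: `φ_d ≥ 0`, `φ_d` is
nondecreasing, and `φ_d(n) = (log (n/d))^k` when `d ∣ n`, `n ≥ 1`. [folklore] -/
theorem logWeight_props {d : ℕ} (k : ℕ) (hd : 1 ≤ d) {w : ℕ → ℝ}
    (hw : ∀ n, w n = max 0 (Real.log ((n : ℝ) / d)) ^ k) :
    (∀ n, 0 ≤ w n) ∧ Monotone w ∧
      ∀ n : ℕ, d ∣ n → 1 ≤ n → w n = Real.log ((n : ℝ) / d) ^ k := by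
  have hd0 : (0 : ℝ) < d := by exact_mod_cast hd
  refine ⟨fun n => by rw [hw]; exact pow_nonneg (le_max_left _ _) _, fun m n hmn => ?_,
    fun n hdn hn => ?_⟩
  · rw [hw, hw]
    refine pow_le_pow_left₀ (le_max_left _ _) ?_ _
    rcases Nat.eq_zero_or_pos m with rfl | hm
    · rw [Nat.cast_zero, zero_div, Real.log_zero, max_self]
      exact le_max_left _ _
    · exact max_le_max le_rfl (Real.log_le_log (div_pos (by exact_mod_cast hm) hd0)
        (div_le_div_of_nonneg_right (by exact_mod_cast hmn) hd0.le))
  · rw [hw, max_eq_right]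
    refine Real.log_nonneg ?_
    rw [le_div_iff₀ hd0, one_mul]
    exact_mod_cast Nat.le_of_dvd hn hdn

/-- The pointwise comparison behind `∑ a_n (log n)^b = A(x)(log x)^b (1 + O(b β(x)))`
([FriedlanderIwaniecPisa1978] p. 739): for `1 ≤ d ≤ x` and `1 ≤ n ≤ x`,
`0 ≤ (log x/d)^k − φ_d(n) ≤ k (log x)^{k−1} (log x − log n)`
(`u^k − v^k ≤ k u^{k−1}(u − v)` for `0 ≤ v ≤ u`). [folklore] -/
theorem pow_log_sub_logWeight_bounds {k d n : ℕ} {x : ℝ} (hd : 1 ≤ d) (hdx : (d : ℝ) ≤ x)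
    (hn : 1 ≤ n) (hnx : (n : ℝ) ≤ x) :
    0 ≤ Real.log (x / d) ^ k - max 0 (Real.log ((n : ℝ) / d)) ^ k ∧
      Real.log (x / d) ^ k - max 0 (Real.log ((n : ℝ) / d)) ^ k ≤
        k * Real.log x ^ (k - 1) * (Real.log x - Real.log n) := by
  have hd0 : (0 : ℝ) < d := by exact_mod_cast hd
  have hn0 : (0 : ℝ) < n := by exact_mod_cast hn
  have hx0 : 0 < x := hd0.trans_le hdx
  set u := Real.log (x / d) with hu
  set v := max 0 (Real.log ((n : ℝ) / d)) with hv
  have hu' : u = Real.log x - Real.log d := Real.log_div hx0.ne' hd0.ne'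
  have hlogd : 0 ≤ Real.log d := Real.log_nonneg (by exact_mod_cast hd)
  have hlogn : Real.log n ≤ Real.log x := Real.log_le_log hn0 hnx
  have hu0 : 0 ≤ u := Real.log_nonneg ((one_le_div hd0).mpr hdx)
  have hv0 : 0 ≤ v := le_max_left _ _
  have hvu : v ≤ u := max_le hu0 (Real.log_le_log (div_pos hn0 hd0)
    (div_le_div_of_nonneg_right hnx hd0.le))
  have hule : u ≤ Real.log x := by linarith
  have huv : u - v ≤ Real.log x - Real.log n := by
    have : Real.log ((n : ℝ) / d) ≤ v := le_max_right _ _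
    rw [Real.log_div hn0.ne' hd0.ne'] at this
    linarith
  have hlx0 : 0 ≤ Real.log x - Real.log n := by linarith
  constructor
  · exact sub_nonneg.mpr (pow_le_pow_left₀ hv0 hvu k)
  · -- `u^k − v^k = (∑_{i<k} u^i v^{k−1−i}) (u − v) ≤ k u^{k−1} (u − v)`
    have hgeom := geom_sum₂_mul u v k
    have hS : ∑ i ∈ Finset.range k, u ^ i * v ^ (k - 1 - i) ≤ k * u ^ (k - 1) := by
      have hterm : ∀ i ∈ Finset.range k, u ^ i * v ^ (k - 1 - i) ≤ u ^ (k - 1) := by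
        intro i hi
        have hik : i + (k - 1 - i) = k - 1 := by
          have := Finset.mem_range.mp hi
          omega
        calc u ^ i * v ^ (k - 1 - i) ≤ u ^ i * u ^ (k - 1 - i) :=
              mul_le_mul_of_nonneg_left (pow_le_pow_left₀ hv0 hvu _) (pow_nonneg hu0 _)
          _ = u ^ (k - 1) := by rw [← pow_add, hik]
      refine (Finset.sum_le_sum hterm).trans ?_
      rw [Finset.sum_const, Finset.card_range, nsmul_eq_mul]
    calc u ^ k - v ^ k = (∑ i ∈ Finset.range k, u ^ i * v ^ (k - 1 - i)) * (u - v) := hgeom.symm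
      _ ≤ k * u ^ (k - 1) * (u - v) :=
          mul_le_mul_of_nonneg_right hS (sub_nonneg.mpr hvu)
      _ ≤ k * Real.log x ^ (k - 1) * (Real.log x - Real.log n) := by
          refine mul_le_mul (mul_le_mul_of_nonneg_left (pow_le_pow_left₀ hu0 hule _)
            (Nat.cast_nonneg k)) huv (sub_nonneg.mpr hvu) ?_
          exact mul_nonneg (Nat.cast_nonneg k) (pow_nonneg (hu0.trans hule) _)

/-- **`T_d` against `A(x)(log x/d)^k`** ([FriedlanderIwaniecPisa1978] p. 739, "By partial
summation `∑ a_n (log n)^b = A(x)(log x)^b (1 + O(bβ(x)))`", in the form used here): for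
`1 ≤ d ≤ x`, with `T_d = ∑_{n ≤ x} a_n φ_d(n)` and `A(x) = ∑_{n ≤ x} a_n`,
`0 ≤ A(x)(log x/d)^k − T_d ≤ k (log x)^{k−1} ∑_{n ≤ x} a_n (log x − log n)`; the last sum is
`∫₁^x A(t) dt/t = β(x) A(x) log x` (`integral_size_div_eq`). [folklore] -/
theorem size_mul_pow_log_sub_weightedSum_bounds (A : SieveSequence) {k d : ℕ} {x : ℝ}
    (hd : 1 ≤ d) (hdx : (d : ℝ) ≤ x) {w : ℕ → ℝ}
    (hw : ∀ n, w n = max 0 (Real.log ((n : ℝ) / d)) ^ k) :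
    0 ≤ (∑ n ∈ Ioc 0 ⌊x⌋₊, A.a n) * Real.log (x / d) ^ k - ∑ n ∈ Ioc 0 ⌊x⌋₊, A.a n * w n ∧
      (∑ n ∈ Ioc 0 ⌊x⌋₊, A.a n) * Real.log (x / d) ^ k - ∑ n ∈ Ioc 0 ⌊x⌋₊, A.a n * w n ≤
        k * Real.log x ^ (k - 1) * ∑ n ∈ Ioc 0 ⌊x⌋₊, A.a n * (Real.log x - Real.log n) := by
  have hx0 : 0 ≤ x := le_trans (Nat.cast_nonneg d) hdx
  have hterm : ∀ n ∈ Ioc 0 ⌊x⌋₊,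
      0 ≤ A.a n * (Real.log (x / d) ^ k - w n) ∧
        A.a n * (Real.log (x / d) ^ k - w n) ≤
          A.a n * (k * Real.log x ^ (k - 1) * (Real.log x - Real.log n)) := by
    intro n hn
    obtain ⟨hn0, hnN⟩ := Finset.mem_Ioc.mp hn
    have hnx : (n : ℝ) ≤ x := (Nat.cast_le.mpr hnN).trans (Nat.floor_le hx0)
    obtain ⟨h0, h1⟩ := pow_log_sub_logWeight_bounds (k := k) hd hdx hn0 hnx
    rw [hw n]
    exact ⟨mul_nonneg (A.a_nonneg n) h0, mul_le_mul_of_nonneg_left h1 (A.a_nonneg n)⟩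
  have hrw : (∑ n ∈ Ioc 0 ⌊x⌋₊, A.a n) * Real.log (x / d) ^ k - ∑ n ∈ Ioc 0 ⌊x⌋₊, A.a n * w n =
      ∑ n ∈ Ioc 0 ⌊x⌋₊, A.a n * (Real.log (x / d) ^ k - w n) := by
    rw [Finset.sum_mul, ← Finset.sum_sub_distrib]
    exact Finset.sum_congr rfl fun n _ => by ring
  rw [hrw]
  refine ⟨Finset.sum_nonneg fun n hn => (hterm n hn).1, ?_⟩
  calc ∑ n ∈ Ioc 0 ⌊x⌋₊, A.a n * (Real.log (x / d) ^ k - w n)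
      ≤ ∑ n ∈ Ioc 0 ⌊x⌋₊, A.a n * (k * Real.log x ^ (k - 1) * (Real.log x - Real.log n)) :=
        Finset.sum_le_sum fun n hn => (hterm n hn).2
    _ = k * Real.log x ^ (k - 1) * ∑ n ∈ Ioc 0 ⌊x⌋₊, A.a n * (Real.log x - Real.log n) := by
        rw [Finset.mul_sum]
        exact Finset.sum_congr rfl fun n _ => by ring

/-- **`β(x) A(x) log x = ∫₁^x A(t) dt/t = ∑_{n ≤ x} a_n log (x/n)`** for the counting function
`A(t) = ∑_{n ≤ t} a_n` and `x ≥ 1` (partial summation against `log`,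
`SelbergSymmetry.sum_mul_log_eq`). [folklore] -/
theorem integral_size_div_eq (A : SieveSequence) (hsize : ∀ x, A.size x = A.congrSum 1 x)
    {x : ℝ} (hx : 1 ≤ x) :
    ∫ t in (1 : ℝ)..x, A.size t / t = ∑ n ∈ Ioc 0 ⌊x⌋₊, A.a n * (Real.log x - Real.log n) := by
  set c : ℕ → ℝ := fun n => if n = 0 then 0 else A.a n with hc
  have hcsum : ∀ m : ℕ, ∑ n ∈ Ioc 0 m, c n = ∑ n ∈ Ioc 0 m, A.a n := fun m =>
    Finset.sum_congr rfl fun n hn => if_neg (Finset.mem_Ioc.mp hn).1.ne'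
  have hsz : ∀ t : ℝ, A.size t = ∑ n ∈ Ioc 0 ⌊t⌋₊, A.a n := fun t => by
    rw [hsize, SieveSequence.congrSum, Finset.filter_true_of_mem (fun n _ => one_dvd n)]
  have key := SelbergSymmetry.sum_mul_log_eq c (if_pos rfl) x
  have hI : ∫ t in Set.Ioc 1 x, (∑ n ∈ Ioc 0 ⌊t⌋₊, c n) / t = ∫ t in Set.Ioc 1 x, A.size t / t :=
    setIntegral_congr_fun measurableSet_Ioc fun t _ => by rw [hcsum, ← hsz]
  have hL : ∑ n ∈ Ioc 0 ⌊x⌋₊, c n * Real.log n = ∑ n ∈ Ioc 0 ⌊x⌋₊, A.a n * Real.log n :=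
    Finset.sum_congr rfl fun n hn => by rw [show c n = A.a n from if_neg (Finset.mem_Ioc.mp hn).1.ne']
  rw [hI, hcsum, hL] at key
  rw [intervalIntegral.integral_of_le hx]
  have : ∑ n ∈ Ioc 0 ⌊x⌋₊, A.a n * (Real.log x - Real.log n) =
      (∑ n ∈ Ioc 0 ⌊x⌋₊, A.a n) * Real.log x - ∑ n ∈ Ioc 0 ⌊x⌋₊, A.a n * Real.log n := by
    rw [Finset.sum_mul, ← Finset.sum_sub_distrib]
    exact Finset.sum_congr rfl fun n _ => by ring
  linarith

/-! ### `Σ₁` rearranged -/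

/-- For `n ≥ 1`: `∑_{d ∣ n, d < y} μ(d)(log (n/d))^k = ∑_{d ∣ n, d < y} μ(d) φ_d(n)`
(`truncLambdaLower` over the divisors instead of the antidiagonal). [folklore] -/
theorem truncLambdaLower_eq_sum_divisors (k : ℕ) (y : ℝ) {n : ℕ} (hn : n ≠ 0) :
    truncLambdaLower k y n =
      ∑ d ∈ n.divisors.filter (fun d : ℕ => (d : ℝ) < y),
        (μ d : ℝ) * max 0 (Real.log ((n : ℝ) / d)) ^ k := by
  rw [truncLambdaLower, Finset.sum_filter, Finset.sum_filter,
    Nat.sum_divisorsAntidiagonal (f := fun a b : ℕ =>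
      if ((a : ℕ) : ℝ) < y then (μ a : ℝ) * Real.log b ^ k else 0)]
  refine Finset.sum_congr rfl fun d hd => ?_
  have hdn : d ∣ n := Nat.dvd_of_mem_divisors hd
  have hd0 : d ≠ 0 := fun h => hn (Nat.eq_zero_of_zero_dvd (h ▸ hdn))
  have hcast : ((n / d : ℕ) : ℝ) = (n : ℝ) / d :=
    Nat.cast_div hdn (by exact_mod_cast hd0)
  have hge : 0 ≤ Real.log ((n : ℝ) / d) := by
    refine Real.log_nonneg ?_
    rw [le_div_iff₀ (by exact_mod_cast Nat.pos_of_ne_zero hd0), one_mul]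
    exact_mod_cast Nat.le_of_dvd (Nat.pos_of_ne_zero hn) hdn
  simp only [hcast, max_eq_right hge]

/-- **`Σ₁` over the divisor first** ([FriedlanderIwaniecPisa1978] p. 738, last display, without
the binomial expansion): `Σ₁ = ∑_{d < y, (d, P(z)) = 1} μ(d) ∑_{n ≤ x, (n,P(z))=1, d ∣ n} a_n φ_d(n)`
(for `d ∣ n` with `(n, P(z)) = 1`, also `(d, P(z)) = 1`, and `φ_d(n) = (log n/d)^k`).
[cite: FriedlanderIwaniecPisa1978, Lemma 12 (proof, p. 738)] -/
theorem sigma1_eq_sum_moebius_mul (A : SieveSequence) (k : ℕ) (x y z : ℝ) :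
    sigma1 A k x y z =
      ∑ d ∈ (Ico 1 ⌈y⌉₊).filter (fun d : ℕ => d.Coprime (primesProdBelow z)),
        (μ d : ℝ) * ∑ n ∈ (Ioc 0 ⌊x⌋₊).filter
            (fun n : ℕ => n.Coprime (primesProdBelow z) ∧ d ∣ n),
          A.a n * max 0 (Real.log ((n : ℝ) / d)) ^ k := by
  set P := primesProdBelow z with hP
  set N := ⌊x⌋₊ with hN
  set S := (Ioc 0 N).filter (fun n : ℕ => n.Coprime P) with hS
  -- Step 1: over divisors
  have h1 : sigma1 A k x y z = ∑ n ∈ S, ∑ d ∈ n.divisors.filter (fun d : ℕ => (d : ℝ) < y),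
      A.a n * ((μ d : ℝ) * max 0 (Real.log ((n : ℝ) / d)) ^ k) := by
    rw [sigma1, ← hP, ← hN, ← hS]
    refine Finset.sum_congr rfl fun n hn => ?_
    have hn0 : n ≠ 0 := (Finset.mem_Ioc.mp (Finset.mem_filter.mp hn).1).1.ne'
    rw [truncLambdaLower_eq_sum_divisors k y hn0, mul_comm, Finset.mul_sum]
  -- Step 2: interchange
  have h2 : ∑ n ∈ S, ∑ d ∈ n.divisors.filter (fun d : ℕ => (d : ℝ) < y),
      A.a n * ((μ d : ℝ) * max 0 (Real.log ((n : ℝ) / d)) ^ k) =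
      ∑ d ∈ Ico 1 ⌈y⌉₊, ∑ n ∈ S.filter (fun n : ℕ => d ∣ n),
        A.a n * ((μ d : ℝ) * max 0 (Real.log ((n : ℝ) / d)) ^ k) := by
    refine Finset.sum_comm' fun n d => ?_
    simp only [Finset.mem_filter, Nat.mem_divisors, Finset.mem_Ico, hS, Finset.mem_Ioc]
    constructor
    · rintro ⟨⟨⟨hn0, hnN⟩, hnP⟩, ⟨hdn, -⟩, hdy⟩
      exact ⟨⟨⟨⟨hn0, hnN⟩, hnP⟩, hdn⟩, Nat.pos_of_dvd_of_pos hdn hn0, Nat.lt_ceil.mpr hdy⟩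
    · rintro ⟨⟨⟨⟨hn0, hnN⟩, hnP⟩, hdn⟩, hd1, hdy⟩
      exact ⟨⟨⟨hn0, hnN⟩, hnP⟩, ⟨hdn, hn0.ne'⟩, Nat.lt_ceil.mp hdy⟩
  rw [h1, h2]
  -- Step 3: factor `μ(d)` and restrict to `(d, P) = 1`
  have h3 : ∀ d : ℕ, ∑ n ∈ S.filter (fun n : ℕ => d ∣ n),
      A.a n * ((μ d : ℝ) * max 0 (Real.log ((n : ℝ) / d)) ^ k) =
      (μ d : ℝ) * ∑ n ∈ (Ioc 0 N).filter (fun n : ℕ => n.Coprime P ∧ d ∣ n),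
        A.a n * max 0 (Real.log ((n : ℝ) / d)) ^ k := by
    intro d
    rw [hS, Finset.filter_filter, Finset.mul_sum]
    exact Finset.sum_congr rfl fun n _ => by ring
  simp_rw [h3]
  symm
  refine Finset.sum_subset (Finset.filter_subset _ _) fun d hd hdnot => ?_
  have hdc : ¬ d.Coprime P := fun h => hdnot (Finset.mem_filter.mpr ⟨hd, h⟩)
  rw [Finset.sum_eq_zero fun n hn => ?_, mul_zero]
  obtain ⟨-, hc, hdn⟩ := Finset.mem_filter.mp hn
  exact absurd (Nat.Coprime.coprime_dvd_left hdn hc) hdc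

/-! ### The fundamental lemma for the weighted subsequences -/

/-- **The sieve step of [FriedlanderIwaniecPisa1978] Lemma 12** ("By Lemmata 5 and 7 …",
p. 739), from the fundamental lemma (its uniform form at dimension `1` with constants `K, C_F`,
hypothesis `hFL'`) applied to the auxiliary sifted sequence
`a'_n = 1_{d ∣ n} a_n w(n)`, size `g(d) T` with `T = ∑_{n ≤ x} a_n w(n)`, density `g`:
for `(d, P(z)) = 1`, `g(d) ≥ 0`, `w ≥ 0`, `2 ≤ z ≤ D`,
`|∑_{n ≤ x, (n,P(z))=1, d ∣ n} a_n w(n) − g(d) T V(z)| ≤ C_F g(d) T V(z) e^{−log D/log z} +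
∑_{ν ∣ P(z), ν ≤ D} |∑_{n ≤ x, dν ∣ n} a_n w(n) − g(dν) T|`. [cite: FriedlanderIwaniecPisa1978, Lemma 12 (proof, p. 739)] -/
theorem weighted_sifted_sub_le {K CF : ℝ}
    (hFL' : ∀ A : SieveSequence, HasSieveDimension A.density 1 K → ∀ x z D : ℝ, 2 ≤ z → z ≤ D →
      0 ≤ A.size x →
        |A.sifted x (primesProdBelow z) - A.size x * A.densityProduct (primesProdBelow z)| ≤
          CF * A.size x * A.densityProduct (primesProdBelow z) *
              Real.exp (-(Real.log D / Real.log z)) +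
            ∑ d ∈ (primesProdBelow z).divisors.filter (fun d : ℕ => (d : ℝ) ≤ D),
              |A.remainder d x|)
    (A : SieveSequence) (hK : HasSieveDimension A.density 1 K) {w : ℕ → ℝ} (hw : ∀ n, 0 ≤ w n)
    {d : ℕ} (hd : 0 ≤ A.density d) {z : ℝ} (hdP : d.Coprime (primesProdBelow z)) (x D : ℝ)
    (hz : 2 ≤ z) (hzD : z ≤ D) :
    |(∑ n ∈ (Ioc 0 ⌊x⌋₊).filter (fun n : ℕ => n.Coprime (primesProdBelow z) ∧ d ∣ n),
          A.a n * w n) -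
        A.density d * (∑ n ∈ Ioc 0 ⌊x⌋₊, A.a n * w n) *
          A.densityProduct (primesProdBelow z)| ≤
      CF * (A.density d * ∑ n ∈ Ioc 0 ⌊x⌋₊, A.a n * w n) *
          A.densityProduct (primesProdBelow z) * Real.exp (-(Real.log D / Real.log z)) +
        ∑ ν ∈ (primesProdBelow z).divisors.filter (fun ν : ℕ => (ν : ℝ) ≤ D),
          |(∑ n ∈ (Ioc 0 ⌊x⌋₊).filter (fun n : ℕ => d * ν ∣ n), A.a n * w n) -
              A.density (d * ν) * ∑ n ∈ Ioc 0 ⌊x⌋₊, A.a n * w n| := by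
  set P := primesProdBelow z with hP
  set T : ℝ → ℝ := fun t => ∑ n ∈ Ioc 0 ⌊t⌋₊, A.a n * w n with hT
  set A' : SieveSequence :=
    { a := fun n => (if d ∣ n then A.a n else 0) * w n
      a_nonneg := fun n => mul_nonneg (by split_ifs; exacts [A.a_nonneg n, le_rfl]) (hw n)
      size := fun t => A.density d * T t
      density := A.density
      density_mult := A.density_mult } with hA'
  have hT0 : 0 ≤ T x := Finset.sum_nonneg fun n _ => mul_nonneg (A.a_nonneg n) (hw n)
  have hsz' : A'.size x = A.density d * T x := by rw [hA']
  have hsz : 0 ≤ A'.size x := by rw [hsz']; exact mul_nonneg hd hT0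
  have h := hFL' A' hK x z D hz hzD hsz
  -- identify the pieces of `A'`
  have h1 : A'.sifted x P =
      ∑ n ∈ (Ioc 0 ⌊x⌋₊).filter (fun n : ℕ => n.Coprime P ∧ d ∣ n), A.a n * w n := by
    rw [hA', SieveSequence.sifted]
    simp only [ite_mul, zero_mul]
    rw [Finset.sum_ite, Finset.sum_const_zero, add_zero, Finset.filter_filter]
  have h3 : A'.densityProduct P = A.densityProduct P := by rw [hA']; rfl
  have h4 : ∀ ν ∈ P.divisors.filter (fun ν : ℕ => (ν : ℝ) ≤ D), A'.remainder ν x =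
      (∑ n ∈ (Ioc 0 ⌊x⌋₊).filter (fun n : ℕ => d * ν ∣ n), A.a n * w n) -
        A.density (d * ν) * T x := by
    intro ν hν
    have hνP : ν ∣ P := Nat.dvd_of_mem_divisors (Finset.mem_filter.mp hν).1
    have hdν : d.Coprime ν := hdP.coprime_dvd_right hνP
    rw [SieveSequence.remainder, hsz', hA', SieveSequence.congrSum]
    simp only [ite_mul, zero_mul]
    rw [Finset.sum_ite, Finset.sum_const_zero, add_zero, Finset.filter_filter,
      A.density_mult.map_mul_of_coprime hdν]
    have hfilter : (Ioc 0 ⌊x⌋₊).filter (fun n : ℕ => ν ∣ n ∧ d ∣ n) =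
        (Ioc 0 ⌊x⌋₊).filter (fun n : ℕ => d * ν ∣ n) := by
      refine Finset.filter_congr fun n _ => ⟨fun hh => hdν.mul_dvd_of_dvd_of_dvd hh.2 hh.1,
        fun hh => ⟨(dvd_mul_left ν d).trans hh, (dvd_mul_right d ν).trans hh⟩⟩
    rw [hfilter]
    show _ - A.density ν * (A.density d * T x) = _ - A.density d * A.density ν * T x
    ring
  have h5 : ∑ ν ∈ P.divisors.filter (fun ν : ℕ => (ν : ℝ) ≤ D), |A'.remainder ν x| =
      ∑ ν ∈ P.divisors.filter (fun ν : ℕ => (ν : ℝ) ≤ D),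
        |(∑ n ∈ (Ioc 0 ⌊x⌋₊).filter (fun n : ℕ => d * ν ∣ n), A.a n * w n) -
            A.density (d * ν) * T x| :=
    Finset.sum_congr rfl fun ν hν => by rw [h4 ν hν]
  rw [← hP] at h
  rw [h1, hsz', h3, h5] at h
  simpa only [hT] using h

end BombieriSieve

end Literature.NumberTheory.Sieve

namespace Literature.NumberTheory.Sieve

namespace BombieriSieve

open scoped ArithmeticFunction.Moebius
open MeasureTheory

/-! ### [FriedlanderIwaniecPisa1978] Lemma 12 from the fundamental lemma -/

/-- **[FriedlanderIwaniecPisa1978] Lemma 12, proved from the fundamental lemma of sieve theory**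
(`SieveSequence.fundamental_lemma_uniform`, Halberstam–Richert Thm 2.5 = FI's "Lemma 5", kept as
the hypothesis `hFL`), following the printed proof (pp. 738–739) with one simplification: instead
of expanding `(log n/d)^a = ∑_b (−1)^{a−b} (a choose b) (log d)^{a−b} (log n)^b`, the sieve is
applied directly to the nonnegative weights `a_n φ_d(n)`, `φ_d(n) = (log⁺ n/d)^k`
(`sigma1_eq_sum_moebius_mul`, `weighted_sifted_sub_le`); the error terms are then literally those
of p. 739: "Partial summation (twice)" = `abs_weighted_congrSum_sub_le` (with (A₂), the moduli
`νd < z^s y ≤ x^{1−ε}` being distinct, `sum_coprime_sum_divisors_le`), "By Lemmata 5 and 7" =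
the fundamental lemma at level `z^s` plus `V(z) ≪ 1/log z` (`FI1978_lemma7_rat`) and Lemma 8
(`FI1978_lemma8_rat`) for `∑_{d<y,(d,P(z))=1} g(d)`, "By partial summation
`∑ a_n (log n)^b = A(x)(log x)^b (1 + O(bβ(x)))`" = `size_mul_pow_log_sub_weightedSum_bounds` with
`integral_size_div_eq`, and "Using Lemma 9 we can remove the dependence on `f` from the main
term" = `FI1978_lemma9_rat`. Constants: `η` is that of Lemma 9, `C = C_F C₇ C₈ + 1 + k C₇ C₈ + C₉`,
and the threshold `x₀(ε, s)` is `log x ≥ max(1, 2 C₂(ε) e^s)` with `C₂(ε)` the (A₂)-constant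
for `B = k + 1` (this is where `c(ε)/log x` is absorbed into `e^{−s}`). In the degenerate case
`A ≡ 0` of `density_nonneg_or_size_eq_zero` both sides vanish.
[cite: FriedlanderIwaniecPisa1978, Lemma 12] -/
theorem FI1978_lemma12_of_fundamentalLemma (hFL : SieveSequence.fundamental_lemma_uniform) :
    FI1978_lemma12 := by
  intro A H hA hH k hk
  have hsize := hA.1
  have hA0 : ∀ x, 0 ≤ A.size x := SieveSequence.size_nonneg_of_size_eq hsize
  obtain ⟨j, rfl⟩ : ∃ j, k = j + 2 := ⟨k - 2, by omega⟩
  simp only [show j + 2 - 1 = j + 1 from by omega, show j + 2 - 2 = j from by omega]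
  have hAsum : ∀ x : ℝ, ∑ n ∈ Ioc 0 ⌊x⌋₊, A.a n = A.size x := fun x => by
    rw [hsize x, SieveSequence.congrSum, Finset.filter_true_of_mem (fun n _ => one_dvd n)]
  rcases density_nonneg_or_size_eq_zero A hA with hg | hzero
  swap
  · -- degenerate case: all `a_n` vanish
    refine ⟨1, one_pos, 0, fun ε hε s hs => Filter.Eventually.of_forall fun x y z _ _ _ => ?_⟩
    have ha : ∀ n ∈ Ioc 0 ⌊x⌋₊, A.a n = 0 :=
      (Finset.sum_eq_zero_iff_of_nonneg fun n _ => A.a_nonneg n).mp ((hAsum x).trans (hzero x))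
    have hs1 : sigma1 A (j + 2) x y z = 0 := by
      rw [sigma1]
      exact Finset.sum_eq_zero fun n hn => by rw [ha n (Finset.mem_filter.mp hn).1, mul_zero]
    rw [hs1, hzero x]
    simp
  -- the constants
  obtain ⟨K, hK⟩ := hasSieveDimension A hA hg
  obtain ⟨CF, hCF0, hFL'⟩ := hFL 1 K
  obtain ⟨H₇, hH₇0, hH₇, η₇, hη₇, C₇, h7⟩ := FI1978_lemma7_rat A hA
  have hHH : H = H₇ := tendsto_nhds_unique hH hH₇
  subst hHH
  obtain ⟨C₈, h8⟩ := FI1978_lemma8_rat A hA.2.1 hA.2.2.2.2.2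
  obtain ⟨η, hη0, C₉, h9⟩ := FI1978_lemma9_rat A H hA hH
  set C₇' := max C₇ 0 with hC₇'
  set C₈' := max C₈ 0 with hC₈'
  set C₉' := max C₉ 0 with hC₉'
  have hC₇'0 : 0 ≤ C₇' := le_max_right _ _
  have hC₈'0 : 0 ≤ C₈' := le_max_right _ _
  have hC₉'0 : 0 ≤ C₉' := le_max_right _ _
  refine ⟨η, hη0, CF * C₇' * C₈' + 1 + (j + 2) * C₇' * C₈' + C₉', fun ε hε s hs => ?_⟩
  -- (A₂) with this `ε` and `B = k + 1`
  obtain ⟨C₂, hC₂⟩ := hA.2.2.1 ε hε ((j + 3 : ℕ) : ℝ) (by positivity)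
  filter_upwards [hC₂, eventually_ge_atTop (1 : ℝ),
    Real.tendsto_log_atTop.eventually_ge_atTop (max 1 (2 * C₂ * Real.exp s))]
    with x hx2 hx1 hxlog y z hz hy1 hlev
  -- the parameters
  have hx0 : 0 < x := by linarith
  have hlogx1 : 1 ≤ Real.log x := (le_max_left _ _).trans hxlog
  have hC₂log : 2 * C₂ * Real.exp s ≤ Real.log x := (le_max_right _ _).trans hxlog
  have hz0 : 0 < z := by linarith
  have hz1 : 1 < z := by linarith
  have hy0 : 0 < y := by linarith
  have hzs : z ≤ z ^ s := by
    calc z = z ^ (1 : ℝ) := (Real.rpow_one z).symm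
      _ ≤ z ^ s := Real.rpow_le_rpow_of_exponent_le hz1.le (by linarith)
  have hzs0 : 0 < z ^ s := Real.rpow_pos_of_pos hz0 s
  have hx1ε : x ^ (1 - ε) ≤ x := by
    calc x ^ (1 - ε) ≤ x ^ (1 : ℝ) := Real.rpow_le_rpow_of_exponent_le hx1 (by linarith)
      _ = x := Real.rpow_one x
  have hyx : y ≤ x := by
    have h1 : y ≤ z ^ s * y := le_mul_of_one_le_left hy0.le (hz1.le.trans hzs)
    linarith
  have hzx : z ≤ x := by
    have h1 : z ^ s ≤ z ^ s * y := le_mul_of_one_le_right hzs0.le hy1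
    linarith
  have hlogz : 0 < Real.log z := Real.log_pos hz1
  have hlogzx : Real.log z ≤ Real.log x := Real.log_le_log hz0 hzx
  have hlx0 : 0 < Real.log x := by linarith
  set N := ⌊x⌋₊ with hN
  have hNx : (N : ℝ) ≤ x := Nat.floor_le hx0.le
  set P := primesProdBelow z with hP
  set V := A.densityProduct P with hV
  set P₁ := ∏ p ∈ Nat.primesBelow ⌈z⌉₊, (1 - (p : ℝ)⁻¹) with hP₁
  set L := Real.log x with hL
  set Ax := A.size x with hAx
  have hAx0 : 0 ≤ Ax := hA0 x
  have hV0 : 0 ≤ V := by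
    rw [hV, densityProduct_primesProdBelow]
    exact Finset.prod_nonneg fun p hp =>
      (sub_pos.mpr (hA.2.1.2 p (Nat.prime_of_mem_primesBelow hp).one_lt)).le
  have hVle : V ≤ C₇' / Real.log z :=
    (h7 z hz).2.trans (div_le_div_of_nonneg_right (le_max_left _ _) hlogz.le)
  -- the auxiliary height `X₁ = max y z ≤ x` for Lemmata 8, 9
  set X₁ := max y z with hX₁
  have hzX₁ : z ≤ X₁ := le_max_right _ _
  have hX₁x : X₁ ≤ x := max_le hyx hzx
  have hlogX₁ : Real.log X₁ ≤ L := Real.log_le_log (hz0.trans_le hzX₁) hX₁x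
  set M := (Ico 1 ⌈y⌉₊).filter (fun d : ℕ => d.Coprime P) with hM
  have hmemM : ∀ {d : ℕ}, d ∈ M → (1 ≤ d ∧ (d : ℝ) < y) ∧ d.Coprime P := by
    intro d hd
    obtain ⟨hd', hdP⟩ := Finset.mem_filter.mp hd
    obtain ⟨hd1, hdy⟩ := Finset.mem_Ico.mp hd'
    exact ⟨⟨hd1, Nat.lt_ceil.mp hdy⟩, hdP⟩
  have hMsub : M ⊆ (Ioc 0 ⌊X₁⌋₊).filter (fun d : ℕ => d.Coprime P) := by
    intro d hd
    obtain ⟨⟨hd1, hdy⟩, hdP⟩ := hmemM hd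
    refine Finset.mem_filter.mpr ⟨Finset.mem_Ioc.mpr ⟨hd1, Nat.le_floor ?_⟩, hdP⟩
    exact hdy.le.trans (le_max_left _ _)
  -- Lemma 8 and Lemma 9 over `M`
  have hG : ∑ d ∈ M, |A.density d| ≤ C₈' * L / Real.log z := by
    refine (Finset.sum_le_sum_of_subset_of_nonneg hMsub fun _ _ _ => abs_nonneg _).trans ?_
    refine (h8 X₁ z hz hzX₁).trans ?_
    rw [div_le_div_iff_of_pos_right hlogz]
    exact mul_le_mul (le_max_left _ _) hlogX₁ (Real.log_nonneg (hz1.le.trans hzX₁)) hC₈'0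
  have hS9 : ∑ d ∈ M, |A.density d * V - H * P₁ / d| ≤ C₉' * z ^ (-η) * L / Real.log z := by
    refine (Finset.sum_le_sum_of_subset_of_nonneg hMsub fun _ _ _ => abs_nonneg _).trans ?_
    refine (h9 X₁ z hz hzX₁).trans ?_
    rw [div_le_div_iff_of_pos_right hlogz]
    have hzη : 0 ≤ z ^ (-η) := Real.rpow_nonneg hz0.le _
    exact mul_le_mul (mul_le_mul_of_nonneg_right (le_max_left _ _) hzη) hlogX₁
      (Real.log_nonneg (hz1.le.trans hzX₁)) (mul_nonneg hC₉'0 hzη)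
  -- the weights `φ_d`, the sums `T_d`, `W_d`, and `β`
  set w : ℕ → ℕ → ℝ := fun d n => max 0 (Real.log ((n : ℝ) / d)) ^ (j + 2) with hw
  set T : ℕ → ℝ := fun d => ∑ n ∈ Ioc 0 N, A.a n * w d n with hT
  set W : ℕ → ℝ := fun d =>
    ∑ n ∈ (Ioc 0 N).filter (fun n : ℕ => n.Coprime P ∧ d ∣ n), A.a n * w d n with hW
  set I := ∑ n ∈ Ioc 0 N, A.a n * (L - Real.log n) with hI
  have hIeq : ∫ t in (1 : ℝ)..x, A.size t / t = I := integral_size_div_eq A hsize hx1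
  have hI0 : 0 ≤ I := Finset.sum_nonneg fun n hn => by
    have hn := Finset.mem_Ioc.mp hn
    refine mul_nonneg (A.a_nonneg n) (sub_nonneg.mpr (Real.log_le_log ?_ ?_))
    · exact_mod_cast hn.1
    · exact (Nat.cast_le.mpr hn.2).trans hNx
  have hwprops : ∀ {d : ℕ}, 1 ≤ d → (∀ n, 0 ≤ w d n) ∧ Monotone (w d) ∧
      ∀ n : ℕ, d ∣ n → 1 ≤ n → w d n = Real.log ((n : ℝ) / d) ^ (j + 2) :=
    fun hd => logWeight_props (j + 2) hd fun n => rfl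
  have hwN : ∀ {d : ℕ}, 1 ≤ d → w d N ≤ L ^ (j + 2) := by
    intro d hd
    have hd0 : (0 : ℝ) < d := by exact_mod_cast hd
    refine pow_le_pow_left₀ (le_max_left _ _) (max_le hlx0.le ?_) _
    rcases Nat.eq_zero_or_pos N with hN0 | hNpos
    · rw [hN0, Nat.cast_zero, zero_div, Real.log_zero]
      exact hlx0.le
    · calc Real.log ((N : ℝ) / d) ≤ Real.log N :=
            Real.log_le_log (div_pos (by exact_mod_cast hNpos) hd0)
              (div_le_self (Nat.cast_nonneg N) (by exact_mod_cast hd))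
        _ ≤ L := Real.log_le_log (by exact_mod_cast hNpos) hNx
  -- `T_d` against `A(x) (log x/d)^k`
  have hTd : ∀ {d : ℕ}, d ∈ M →
      0 ≤ Ax * Real.log (x / d) ^ (j + 2) - T d ∧
        Ax * Real.log (x / d) ^ (j + 2) - T d ≤ (j + 2 : ℕ) * L ^ (j + 1) * I ∧
        T d ≤ Ax * L ^ (j + 2) := by
    intro d hd
    obtain ⟨⟨hd1, hdy⟩, -⟩ := hmemM hd
    have hdx : (d : ℝ) ≤ x := hdy.le.trans hyx
    have h := size_mul_pow_log_sub_weightedSum_bounds A (k := j + 2) hd1 hdx (w := w d)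
      fun n => rfl
    rw [hAsum x, show j + 2 - 1 = j + 1 from by omega] at h
    refine ⟨h.1, h.2, ?_⟩
    have hd0 : (0 : ℝ) < d := by exact_mod_cast hd1
    have hlxd : Real.log (x / d) ≤ L := by
      rw [Real.log_div hx0.ne' hd0.ne']
      linarith [Real.log_nonneg (show (1 : ℝ) ≤ d by exact_mod_cast hd1)]
    have hlxd0 : 0 ≤ Real.log (x / d) := Real.log_nonneg ((one_le_div hd0).mpr hdx)
    calc T d ≤ Ax * Real.log (x / d) ^ (j + 2) := by linarith [h.1]
      _ ≤ Ax * L ^ (j + 2) := mul_le_mul_of_nonneg_left (pow_le_pow_left₀ hlxd0 hlxd _) hAx0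
  -- the selection `m_q ≤ N` maximising `|R(m; q)|`, and (A₂)
  have hne : (Finset.range (N + 1)).Nonempty := ⟨0, by simp⟩
  choose msel hmsel using fun q : ℕ =>
    Finset.exists_max_image (Finset.range (N + 1)) (fun m : ℕ => |A.remainder q (m : ℝ)|) hne
  set Rstar : ℕ → ℝ := fun q => |A.remainder q (msel q : ℝ)| with hRstar
  have hRstar0 : ∀ q, 0 ≤ Rstar q := fun q => abs_nonneg _
  have hRle : ∀ q m : ℕ, m ≤ N → |A.remainder q (m : ℝ)| ≤ Rstar q := fun q m hm =>
    (hmsel q).2 m (Finset.mem_range.mpr (Nat.lt_succ_of_le hm))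
  have hA2 : ∑ q ∈ Ico 1 ⌈x ^ (1 - ε)⌉₊, Rstar q ≤ C₂ * Ax / L ^ (j + 3) := by
    have h := hx2 (fun q => (msel q : ℝ)) fun q =>
      (Nat.cast_le.mpr (Nat.lt_succ_iff.mp (Finset.mem_range.mp (hmsel q).1))).trans hNx
    rwa [Real.rpow_natCast] at h
  -- Step 1: `Σ₁` over `d` first
  have hSig : sigma1 A (j + 2) x y z = ∑ d ∈ M, (μ d : ℝ) * W d := by
    rw [sigma1_eq_sum_moebius_mul]
  -- Step 2: the sieve bound for each `d ∈ M`
  have hWd : ∀ {d : ℕ}, d ∈ M → |W d - A.density d * T d * V| ≤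
      CF * Real.exp (-s) * V * Ax * L ^ (j + 2) * |A.density d| +
        2 * L ^ (j + 2) * ∑ ν ∈ P.divisors.filter (fun ν : ℕ => (ν : ℝ) ≤ z ^ s),
          Rstar (d * ν) := by
    intro d hd
    obtain ⟨⟨hd1, hdy⟩, hdP⟩ := hmemM hd
    have hgd : 0 ≤ A.density d := hg d hd1
    obtain ⟨hw0, hwmono, -⟩ := hwprops hd1
    have h := weighted_sifted_sub_le hFL' A hK hw0 hgd hdP x (z ^ s) hz hzs
    have hexp : Real.exp (-(Real.log (z ^ s) / Real.log z)) = Real.exp (-s) := by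
      rw [Real.log_rpow hz0, mul_div_assoc, div_self hlogz.ne', mul_one]
    rw [hexp] at h
    -- the remainders
    have hrem : ∀ ν ∈ P.divisors.filter (fun ν : ℕ => (ν : ℝ) ≤ z ^ s),
        |(∑ n ∈ (Ioc 0 N).filter (fun n : ℕ => d * ν ∣ n), A.a n * w d n) -
            A.density (d * ν) * ∑ n ∈ Ioc 0 N, A.a n * w d n| ≤
          2 * L ^ (j + 2) * Rstar (d * ν) := by
      intro ν hν
      refine (abs_weighted_congrSum_sub_le A hsize hw0 hwmono (d * ν) N
        (fun m hm => hRle (d * ν) m hm)).trans ?_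
      calc 2 * Rstar (d * ν) * w d N ≤ 2 * Rstar (d * ν) * L ^ (j + 2) :=
            mul_le_mul_of_nonneg_left (hwN hd1) (mul_nonneg zero_le_two (hRstar0 _))
        _ = 2 * L ^ (j + 2) * Rstar (d * ν) := by ring
    have hmain : CF * (A.density d * T d) * V * Real.exp (-s) ≤
        CF * Real.exp (-s) * V * Ax * L ^ (j + 2) * |A.density d| := by
      rw [abs_of_nonneg hgd]
      have hT3 := (hTd hd).2.2
      calc CF * (A.density d * T d) * V * Real.exp (-s)
          = (CF * Real.exp (-s) * V * A.density d) * T d := by ring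
        _ ≤ (CF * Real.exp (-s) * V * A.density d) * (Ax * L ^ (j + 2)) :=
            mul_le_mul_of_nonneg_left hT3 (mul_nonneg (mul_nonneg (mul_nonneg hCF0.le
              (Real.exp_pos _).le) hV0) hgd)
        _ = CF * Real.exp (-s) * V * Ax * L ^ (j + 2) * A.density d := by ring
    calc |W d - A.density d * T d * V|
        ≤ CF * (A.density d * T d) * V * Real.exp (-s) +
            ∑ ν ∈ P.divisors.filter (fun ν : ℕ => (ν : ℝ) ≤ z ^ s),
              |(∑ n ∈ (Ioc 0 N).filter (fun n : ℕ => d * ν ∣ n), A.a n * w d n) -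
                  A.density (d * ν) * ∑ n ∈ Ioc 0 N, A.a n * w d n| := h
      _ ≤ CF * Real.exp (-s) * V * Ax * L ^ (j + 2) * |A.density d| +
            ∑ ν ∈ P.divisors.filter (fun ν : ℕ => (ν : ℝ) ≤ z ^ s),
              2 * L ^ (j + 2) * Rstar (d * ν) := add_le_add hmain (Finset.sum_le_sum hrem)
      _ = _ := by rw [Finset.mul_sum]
  -- Step 3: the term-by-term bound for `Σ₁ − H A(x) F`
  have hterm : ∀ d ∈ M,
      |(μ d : ℝ) * W d - H * Ax * (P₁ * ((μ d : ℝ) / d * Real.log (x / d) ^ (j + 2)))| ≤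
        CF * Real.exp (-s) * V * Ax * L ^ (j + 2) * |A.density d| +
          2 * L ^ (j + 2) * ∑ ν ∈ P.divisors.filter (fun ν : ℕ => (ν : ℝ) ≤ z ^ s),
            Rstar (d * ν) +
          (j + 2 : ℕ) * L ^ (j + 1) * I * V * |A.density d| +
          Ax * L ^ (j + 2) * |A.density d * V - H * P₁ / d| := by
    intro d hd
    obtain ⟨⟨hd1, hdy⟩, hdP⟩ := hmemM hd
    have hgd : 0 ≤ A.density d := hg d hd1
    have hd0 : (0 : ℝ) < d := by exact_mod_cast hd1
    have hdx : (d : ℝ) ≤ x := hdy.le.trans hyx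
    have hlxd : Real.log (x / d) ≤ L := by
      rw [Real.log_div hx0.ne' hd0.ne']
      linarith [Real.log_nonneg (show (1 : ℝ) ≤ d by exact_mod_cast hd1)]
    have hlxd0 : 0 ≤ Real.log (x / d) := Real.log_nonneg ((one_le_div hd0).mpr hdx)
    obtain ⟨hT1, hT2, -⟩ := hTd hd
    have hμ : |(μ d : ℝ)| ≤ 1 := by
      rw [← Int.cast_abs]
      exact_mod_cast ArithmeticFunction.abs_moebius_le_one
    have hid : (μ d : ℝ) * W d - H * Ax * (P₁ * ((μ d : ℝ) / d * Real.log (x / d) ^ (j + 2))) =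
        (μ d : ℝ) * ((W d - A.density d * T d * V) +
          A.density d * V * (T d - Ax * Real.log (x / d) ^ (j + 2)) +
          Ax * Real.log (x / d) ^ (j + 2) * (A.density d * V - H * P₁ / d)) := by ring
    rw [hid, abs_mul]
    refine (mul_le_of_le_one_left (abs_nonneg _) hμ).trans ?_
    refine (abs_add_three _ _ _).trans ?_
    have h2 : |A.density d * V * (T d - Ax * Real.log (x / d) ^ (j + 2))| ≤
        (j + 2 : ℕ) * L ^ (j + 1) * I * V * |A.density d| := by
      rw [abs_of_nonneg hgd, show A.density d * V * (T d - Ax * Real.log (x / d) ^ (j + 2)) =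
        -(A.density d * V * (Ax * Real.log (x / d) ^ (j + 2) - T d)) by ring, abs_neg,
        abs_of_nonneg (mul_nonneg (mul_nonneg hgd hV0) hT1)]
      calc A.density d * V * (Ax * Real.log (x / d) ^ (j + 2) - T d)
          ≤ A.density d * V * ((j + 2 : ℕ) * L ^ (j + 1) * I) :=
            mul_le_mul_of_nonneg_left hT2 (mul_nonneg hgd hV0)
        _ = (j + 2 : ℕ) * L ^ (j + 1) * I * V * A.density d := by ring
    have h3 : |Ax * Real.log (x / d) ^ (j + 2) * (A.density d * V - H * P₁ / d)| ≤
        Ax * L ^ (j + 2) * |A.density d * V - H * P₁ / d| := by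
      rw [abs_mul, abs_of_nonneg (mul_nonneg hAx0 (pow_nonneg hlxd0 _))]
      exact mul_le_mul_of_nonneg_right
        (mul_le_mul_of_nonneg_left (pow_le_pow_left₀ hlxd0 hlxd _) hAx0) (abs_nonneg _)
    linarith [hWd hd, h2, h3]
  -- Step 4: summing over `d ∈ M`
  have hF : H * Ax * mainTermF (j + 2) x y z =
      ∑ d ∈ M, H * Ax * (P₁ * ((μ d : ℝ) / d * Real.log (x / d) ^ (j + 2))) := by
    rw [mainTermF, ← hP₁, ← hP, ← hM, Finset.mul_sum, Finset.mul_sum]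
  have hRR : ∑ d ∈ M, ∑ ν ∈ P.divisors.filter (fun ν : ℕ => (ν : ℝ) ≤ z ^ s), Rstar (d * ν) ≤
      C₂ * Ax / L ^ (j + 3) := by
    have hM' : ∀ m ∈ M, m ≠ 0 ∧ m.Coprime P := fun m hm =>
      ⟨by have := (hmemM hm).1.1; omega, (hmemM hm).2⟩
    have hL' : ∀ m ∈ M, (m : ℝ) * z ^ s < x ^ (1 - ε) := by
      intro m hm
      have hmy := (hmemM hm).1.2
      calc (m : ℝ) * z ^ s < y * z ^ s := mul_lt_mul_of_pos_right hmy hzs0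
        _ = z ^ s * y := mul_comm _ _
        _ ≤ x ^ (1 - ε) := hlev
    exact (sum_coprime_sum_divisors_le (primesProdBelow_ne_zero z) Rstar hRstar0 M hM' (z ^ s)
      (x ^ (1 - ε)) hL').trans hA2
  have hsum : |sigma1 A (j + 2) x y z - H * Ax * mainTermF (j + 2) x y z| ≤
      CF * Real.exp (-s) * V * Ax * L ^ (j + 2) * (C₈' * L / Real.log z) +
        2 * L ^ (j + 2) * (C₂ * Ax / L ^ (j + 3)) +
        (j + 2 : ℕ) * L ^ (j + 1) * I * V * (C₈' * L / Real.log z) +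
        Ax * L ^ (j + 2) * (C₉' * z ^ (-η) * L / Real.log z) := by
    rw [hSig, hF, ← Finset.sum_sub_distrib]
    refine (Finset.abs_sum_le_sum_abs _ _).trans ?_
    refine (Finset.sum_le_sum hterm).trans ?_
    rw [Finset.sum_add_distrib, Finset.sum_add_distrib, Finset.sum_add_distrib,
      ← Finset.mul_sum, ← Finset.mul_sum, ← Finset.mul_sum, ← Finset.mul_sum]
    have hg_sum : ∑ d ∈ M, |A.density d| ≤ C₈' * L / Real.log z := hG
    have hc1 : 0 ≤ CF * Real.exp (-s) * V * Ax * L ^ (j + 2) :=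
      mul_nonneg (mul_nonneg (mul_nonneg (mul_nonneg hCF0.le (Real.exp_pos _).le) hV0) hAx0)
        (pow_nonneg hlx0.le _)
    have hc2 : 0 ≤ 2 * L ^ (j + 2) := mul_nonneg zero_le_two (pow_nonneg hlx0.le _)
    have hc3 : 0 ≤ (j + 2 : ℕ) * L ^ (j + 1) * I * V :=
      mul_nonneg (mul_nonneg (mul_nonneg (Nat.cast_nonneg _) (pow_nonneg hlx0.le _)) hI0) hV0
    have hc4 : 0 ≤ Ax * L ^ (j + 2) := mul_nonneg hAx0 (pow_nonneg hlx0.le _)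
    gcongr
  -- Step 5: the final shape
  have hQ1 : 1 ≤ L / Real.log z := by rwa [le_div_iff₀ hlogz, one_mul]
  have hQ : L / Real.log z ≤ (L / Real.log z) ^ 2 := le_self_pow₀ hQ1 two_ne_zero
  have hLj1 : 1 ≤ L ^ (j + 1) := one_le_pow₀ hlogx1
  have hes0 : 0 < Real.exp (-s) := Real.exp_pos _
  have hzη : 0 ≤ z ^ (-η) := Real.rpow_nonneg hz0.le _
  -- term 1
  have ht1 : CF * Real.exp (-s) * V * Ax * L ^ (j + 2) * (C₈' * L / Real.log z) ≤
      CF * C₇' * C₈' * (Real.exp (-s) * Ax * L ^ (j + 1)) * (L / Real.log z) ^ 2 := by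
    have hnn : 0 ≤ CF * Real.exp (-s) * Ax * L ^ (j + 2) * (C₈' * L / Real.log z) :=
      mul_nonneg (mul_nonneg (mul_nonneg (mul_nonneg hCF0.le hes0.le) hAx0)
        (pow_nonneg hlx0.le _)) (div_nonneg (mul_nonneg hC₈'0 hlx0.le) hlogz.le)
    calc CF * Real.exp (-s) * V * Ax * L ^ (j + 2) * (C₈' * L / Real.log z)
        = CF * Real.exp (-s) * Ax * L ^ (j + 2) * (C₈' * L / Real.log z) * V := by ring
      _ ≤ CF * Real.exp (-s) * Ax * L ^ (j + 2) * (C₈' * L / Real.log z) *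
            (C₇' / Real.log z) := mul_le_mul_of_nonneg_left hVle hnn
      _ = CF * C₇' * C₈' * (Real.exp (-s) * Ax * L ^ (j + 1)) * (L / Real.log z) ^ 2 := by
          field_simp
          ring
  -- term 2
  have ht2 : 2 * L ^ (j + 2) * (C₂ * Ax / L ^ (j + 3)) ≤
      1 * (Real.exp (-s) * Ax * L ^ (j + 1)) * (L / Real.log z) ^ 2 := by
    have h2C : 2 * C₂ ≤ L * Real.exp (-s) := by
      have h1 : 2 * C₂ * Real.exp s * Real.exp (-s) ≤ L * Real.exp (-s) :=
        mul_le_mul_of_nonneg_right hC₂log hes0.le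
      rwa [mul_assoc, ← Real.exp_add, add_neg_cancel, Real.exp_zero, mul_one] at h1
    have hLpow : L ^ (j + 3) = L ^ (j + 2) * L := by ring
    calc 2 * L ^ (j + 2) * (C₂ * Ax / L ^ (j + 3))
        = (2 * C₂) * Ax / L := by
          rw [hLpow]
          field_simp
      _ ≤ (L * Real.exp (-s)) * Ax / L :=
          div_le_div_of_nonneg_right (mul_le_mul_of_nonneg_right h2C hAx0) hlx0.le
      _ = Real.exp (-s) * Ax := by field_simp
      _ ≤ Real.exp (-s) * Ax * L ^ (j + 1) := le_mul_of_one_le_right (mul_nonneg hes0.le hAx0) hLj1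
      _ ≤ Real.exp (-s) * Ax * L ^ (j + 1) * (L / Real.log z) ^ 2 :=
          le_mul_of_one_le_right (mul_nonneg (mul_nonneg hes0.le hAx0) (zero_le_one.trans hLj1))
            (one_le_pow₀ hQ1)
      _ = 1 * (Real.exp (-s) * Ax * L ^ (j + 1)) * (L / Real.log z) ^ 2 := by ring
  -- term 3
  have ht3 : (j + 2 : ℕ) * L ^ (j + 1) * I * V * (C₈' * L / Real.log z) ≤
      (j + 2 : ℕ) * C₇' * C₈' * (I * L ^ j) * (L / Real.log z) ^ 2 := by
    have hnn : 0 ≤ (j + 2 : ℕ) * L ^ (j + 1) * I * (C₈' * L / Real.log z) :=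
      mul_nonneg (mul_nonneg (mul_nonneg (Nat.cast_nonneg _) (pow_nonneg hlx0.le _)) hI0)
        (div_nonneg (mul_nonneg hC₈'0 hlx0.le) hlogz.le)
    calc (j + 2 : ℕ) * L ^ (j + 1) * I * V * (C₈' * L / Real.log z)
        = (j + 2 : ℕ) * L ^ (j + 1) * I * (C₈' * L / Real.log z) * V := by ring
      _ ≤ (j + 2 : ℕ) * L ^ (j + 1) * I * (C₈' * L / Real.log z) * (C₇' / Real.log z) :=
          mul_le_mul_of_nonneg_left hVle hnn
      _ = (j + 2 : ℕ) * C₇' * C₈' * (I * L ^ j) * (L / Real.log z) ^ 2 := by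
          field_simp
          ring
  -- term 4
  have ht4 : Ax * L ^ (j + 2) * (C₉' * z ^ (-η) * L / Real.log z) ≤
      C₉' * (z ^ (-η) * Ax * L ^ (j + 2)) * (L / Real.log z) ^ 2 := by
    calc Ax * L ^ (j + 2) * (C₉' * z ^ (-η) * L / Real.log z)
        = C₉' * (z ^ (-η) * Ax * L ^ (j + 2)) * (L / Real.log z) := by ring
      _ ≤ C₉' * (z ^ (-η) * Ax * L ^ (j + 2)) * (L / Real.log z) ^ 2 :=
          mul_le_mul_of_nonneg_left hQ (mul_nonneg hC₉'0 (mul_nonneg (mul_nonneg hzη hAx0)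
            (pow_nonneg hlx0.le _)))
  -- conclusion
  rw [hIeq]
  push_cast at ht3 hsum ⊢
  have hQ0 : 0 ≤ (L / Real.log z) ^ 2 := sq_nonneg _
  have hE₁0 : 0 ≤ Real.exp (-s) * Ax * L ^ (j + 1) :=
    mul_nonneg (mul_nonneg hes0.le hAx0) (pow_nonneg hlx0.le _)
  have hE₂0 : 0 ≤ I * L ^ j := mul_nonneg hI0 (pow_nonneg hlx0.le _)
  have hE₃0 : 0 ≤ z ^ (-η) * Ax * L ^ (j + 2) :=
    mul_nonneg (mul_nonneg hzη hAx0) (pow_nonneg hlx0.le _)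
  have ha0 : 0 ≤ CF * C₇' * C₈' := mul_nonneg (mul_nonneg hCF0.le hC₇'0) hC₈'0
  have hb0 : 0 ≤ ((j : ℝ) + 2) * C₇' * C₈' := mul_nonneg (mul_nonneg (by positivity) hC₇'0) hC₈'0
  have h4 := hsum.trans (add_le_add (add_le_add (add_le_add ht1 ht2) ht3) ht4)
  clear ht1 ht2 ht3 ht4 hsum hterm hWd hF hRR hSig hTd hwN hwprops hA2 hRle hmsel
  generalize (L / Real.log z) ^ 2 = Q at hQ0 h4 ⊢
  generalize Real.exp (-s) * Ax * L ^ (j + 1) = E₁ at hE₁0 h4 ⊢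
  generalize I * L ^ j = E₂ at hE₂0 h4 ⊢
  generalize z ^ (-η) * Ax * L ^ (j + 2) = E₃ at hE₃0 h4 ⊢
  generalize CF * C₇' * C₈' = a at ha0 h4 ⊢
  generalize ((j : ℝ) + 2) * C₇' * C₈' = b at hb0 h4 ⊢
  have hid : (a + 1 + b + C₉') * (E₁ + E₂ + E₃) * Q -
      (a * E₁ * Q + 1 * E₁ * Q + b * E₂ * Q + C₉' * E₃ * Q) =
      Q * (a * (E₂ + E₃) + (E₂ + E₃) + b * (E₁ + E₃) + C₉' * (E₁ + E₂)) := by ring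
  have h0 : 0 ≤ Q * (a * (E₂ + E₃) + (E₂ + E₃) + b * (E₁ + E₃) + C₉' * (E₁ + E₂)) :=
    mul_nonneg hQ0 (add_nonneg (add_nonneg (add_nonneg (mul_nonneg ha0 (add_nonneg hE₂0 hE₃0))
      (add_nonneg hE₂0 hE₃0)) (mul_nonneg hb0 (add_nonneg hE₁0 hE₃0)))
      (mul_nonneg hC₉'0 (add_nonneg hE₁0 hE₂0)))
  linarith only [h4, hid, h0]

end BombieriSieve

end Literature.NumberTheory.Sieve
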